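import Summits.QuantumFields.YangMills.Theorems.BalabanUVNodesN19BirkhoffContraction

/-!
# BalabanUVNodes ∕ N19 (NE7) — BIRKHOFF's CONTRACTION THEOREM, IV: PROJECTIVE DIAMETERS OF COMPOSITE STEPS
# (`Δ(M∘N) ≤ min (Δ_M, Δ_N, tanh(Δ_M∕4)·Δ_N, tanh(Δ_N∕4)·Δ_M)` — how a block of finite-range steps acquires a finite diameter)

Cell `pub-ymgap` (HUMAN RULING D-0062 Track A; D-0149 width seats), seat `pub-ymgap-dag-n19-w2` (WIDTH SEAT 2 of 3 on NODE n19 = NE7), generation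
g6, CLAIM-3 (INBOX).  Route `Summits/QuantumFields/YangMills/Theses/BalabanUVNodes.lean`, key item K3⁷ `SpineGivenEndpointR13SepCoPH`
(stmt-QuantumFields-20544); filed `--kind proof --supports … --as helper`.  COUNT-NEUTRAL.  THEOREMS ONLY (0 `def`, 0 `sorry`).  ADDITIVE — imports this
seat's g6 `…N19BirkhoffContraction` (p618587: `two_rows_le_exp_diam`, `two_rows_le_exp_tanh_mul`) ONLY; modifies nothing.

WHY.  `…N19CoreCommonStep` §3–§4 contract the class half of `Spine.NE7.Core` under a common step whose good rows are POSITIVE with finite cross-ratio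
diameter `Δ`.  A single renormalisation step has FINITE RANGE (block averaging: a coarse class sees only the fine classes under it), i.e. ZERO entries —
infinite diameter, no contraction.  What contracts is a BLOCK of consecutive common steps once the composite kernel is positive (primitivity), and this
file types how the diameter of a composite is controlled by its factors [folklore] (Birkhoff 1957; Eveson–Nussbaum 1995 §3: `N(L₁L₂) ≤ N(L₁)N(L₂)`):
* §1 ★★ `crossRatio_comp_le_exp_diam_left` — for `M` with positive rows of diameter `≤ Δ_M` on the middle index and ANY non-negative `N`:
  `(MN) σ k·(MN) σ′ l ≤ e^{Δ_M}·(MN) σ l·(MN) σ′ k` (the composite's diameter is at most the LEFT factor's; p618587 `two_rows_le_exp_diam` at the columns of `N`)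
  · ★★ `crossRatio_comp_le_exp_diam_right` — … and at most the RIGHT factor's (`N` with positive columns of diameter `≤ Δ_N`, ANY non-negative `M`).
* §2 ★★ `crossRatio_comp_le_exp_tanh_mul` — BOTH factors positive with diameters `Δ_M`, `Δ_N`: `(MN) σ k·(MN) σ′ l ≤ e^{tanh(Δ_M∕4)·Δ_N}·(MN) σ l·(MN) σ′ k`
  (p618587 `two_rows_le_exp_tanh_mul` at rows of `M`, columns of `N`): Birkhoff's coefficients MULTIPLY along a composite, so a long block of positive
  steps has diameter `→ 0` geometrically — and a block `M∘N` with `N` of finite range but `M∘N` positive inherits `Δ ≤ Δ_M`-type bounds from §1 as soon as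
  ONE factorisation with a positive finite-diameter factor exists.
* §3 `comp_pos` — positivity of the composite from a positive left factor and a non-negative right factor with no zero column (bookkeeping for §1–§2's use).

HONEST FRAMING.  Count-neutral helper; [folklore] on hypothesis SHAPES; ZERO Bałaban content — no block of RG steps of [Balaban1988Convergent] ∕
[Balaban1989LargeFieldI ∕ II] is shown to be positive with finite diameter on the good classes (and realistic diameters are volume-extensive,
`…N19BirkhoffContractionSharp.crossRatio_le_of_boltzmann`); NE2–NE7 ∕ NE1′ NOT PRINTED for d = 4 ∕ NOT proved; N19 NOT discharged; K3⁷ OPEN, v5 untouched,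
not claimed; counts UNMOVED (typed 28∕28 · discharged 5∕27, A 5∕28); no count claim.  One finite 𝕋⁴ programme at fixed ε, Bałaban AS PRINTED; R4 closes the
conditional finite-𝕋⁴ rung `BalabanLadder.UV` only — the YM mass gap (Clay) is NOT proved by any of this; nothing continuum ∕ ℝ⁴ ∕ OS.  No `def`, no
`instance`, no `sorry`; standard axioms.
-/

noncomputable section

open Finset Real
open Summit.QuantumFields.YangMills.BalabanUVNodes.N19BirkhoffContraction (two_rows_le_exp_diam two_rows_le_exp_tanh_mul)

namespace Summit.QuantumFields.YangMills.BalabanUVNodes.N19BirkhoffContractionComposite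

variable {κ ι ν : Type*} {R : Finset κ} {s : Finset ι} {C : Finset ν} {M : κ → ι → ℝ} {N : ι → ν → ℝ} {ΔM ΔN : ℝ}

/-! ## §1 The composite's diameter is at most either factor's -/

/-- **★★ `Δ(M∘N) ≤ Δ_M`** [folklore]: `M` with positive rows on `R × s` of cross-ratio diameter `≤ Δ_M`, `N ≥ 0` on `s × C` ⇒ the composite
`(MN) σ k = Σ_{τ ∈ s} M σ τ·N τ k` has cross-ratios `≤ e^{Δ_M}` on `R × C`. -/
theorem crossRatio_comp_le_exp_diam_left (hN : ∀ τ ∈ s, ∀ k ∈ C, 0 ≤ N τ k)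
    (hMM : ∀ σ ∈ R, ∀ σ' ∈ R, ∀ τ ∈ s, ∀ τ' ∈ s, M σ τ * M σ' τ' ≤ exp ΔM * (M σ τ' * M σ' τ)) :
    ∀ σ ∈ R, ∀ σ' ∈ R, ∀ k ∈ C, ∀ l ∈ C,
      (∑ τ ∈ s, M σ τ * N τ k) * (∑ τ ∈ s, M σ' τ * N τ l) ≤ exp ΔM * ((∑ τ ∈ s, M σ τ * N τ l) * (∑ τ ∈ s, M σ' τ * N τ k)) := by
  intro σ hσ σ' hσ' k hk l hl
  exact two_rows_le_exp_diam (s := s) (a := M σ) (b := M σ') (x := fun τ => N τ l) (y := fun τ => N τ k)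
    (fun τ hτ => hN τ hτ l hl) (fun τ hτ => hN τ hτ k hk) (fun τ hτ τ' hτ' => hMM σ hσ σ' hσ' τ hτ τ' hτ')

/-- **★★ `Δ(M∘N) ≤ Δ_N`** [folklore]: `M ≥ 0` on `R × s`, `N` with positive entries on `s × C` whose cross-ratios (rows `τ, τ′`, columns `k, l`) are
`≤ e^{Δ_N}` ⇒ the composite has cross-ratios `≤ e^{Δ_N}` on `R × C`.  (The same lemma read on the transposed kernels.) -/
theorem crossRatio_comp_le_exp_diam_right (hM : ∀ σ ∈ R, ∀ τ ∈ s, 0 ≤ M σ τ)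
    (hNN : ∀ τ ∈ s, ∀ τ' ∈ s, ∀ k ∈ C, ∀ l ∈ C, N τ k * N τ' l ≤ exp ΔN * (N τ l * N τ' k)) :
    ∀ σ ∈ R, ∀ σ' ∈ R, ∀ k ∈ C, ∀ l ∈ C,
      (∑ τ ∈ s, M σ τ * N τ k) * (∑ τ ∈ s, M σ' τ * N τ l) ≤ exp ΔN * ((∑ τ ∈ s, M σ τ * N τ l) * (∑ τ ∈ s, M σ' τ * N τ k)) := by
  intro σ hσ σ' hσ' k hk l hl
  -- rows := the columns `N · k`, `N · l` (indexed by `τ`); vectors := the rows `M σ′`, `M σ`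
  have h := two_rows_le_exp_diam (s := s) (a := fun τ => N τ k) (b := fun τ => N τ l) (x := M σ') (y := M σ) (Δ := ΔN)
    (fun τ hτ => hM σ' hσ' τ hτ) (fun τ hτ => hM σ hσ τ hτ)
    (fun τ hτ τ' hτ' => mul_comm (N τ l) (N τ' k) ▸ hNN τ hτ τ' hτ' k hk l hl)
  have e1 : ∑ τ ∈ s, N τ k * M σ τ = ∑ τ ∈ s, M σ τ * N τ k := Finset.sum_congr rfl fun τ _ => mul_comm _ _
  have e2 : ∑ τ ∈ s, N τ l * M σ' τ = ∑ τ ∈ s, M σ' τ * N τ l := Finset.sum_congr rfl fun τ _ => mul_comm _ _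
  have e3 : ∑ τ ∈ s, N τ k * M σ' τ = ∑ τ ∈ s, M σ' τ * N τ k := Finset.sum_congr rfl fun τ _ => mul_comm _ _
  have e4 : ∑ τ ∈ s, N τ l * M σ τ = ∑ τ ∈ s, M σ τ * N τ l := Finset.sum_congr rfl fun τ _ => mul_comm _ _
  rw [e1, e2, e3, e4] at h
  calc (∑ τ ∈ s, M σ τ * N τ k) * (∑ τ ∈ s, M σ' τ * N τ l) = (∑ τ ∈ s, M σ τ * N τ k) * (∑ τ ∈ s, M σ' τ * N τ l) := rfl
    _ ≤ exp ΔN * ((∑ τ ∈ s, M σ' τ * N τ k) * (∑ τ ∈ s, M σ τ * N τ l)) := h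
    _ = exp ΔN * ((∑ τ ∈ s, M σ τ * N τ l) * (∑ τ ∈ s, M σ' τ * N τ k)) := by ring

/-! ## §2 Birkhoff's coefficients multiply along a composite -/

/-- **★★ `Δ(M∘N) ≤ tanh(Δ_M∕4)·Δ_N`** [folklore] (Birkhoff 1957; Eveson–Nussbaum 1995 Thm 3.5): `M` with POSITIVE rows on `R × s` of diameter `≤ Δ_M`, `N`
with POSITIVE entries on `s × C` of diameter `≤ Δ_N` (`Δ_M, Δ_N ≥ 0`) ⇒ the composite has cross-ratios `≤ e^{tanh(Δ_M∕4)·Δ_N}` on `R × C`.  With §1 this is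
`Δ(M∘N) ≤ min(Δ_M, Δ_N, tanh(Δ_M∕4)·Δ_N)`; by the transposed reading also `≤ tanh(Δ_N∕4)·Δ_M`. -/
theorem crossRatio_comp_le_exp_tanh_mul (hΔM : 0 ≤ ΔM) (hΔN : 0 ≤ ΔN)
    (hM : ∀ σ ∈ R, ∀ τ ∈ s, 0 < M σ τ) (hN : ∀ τ ∈ s, ∀ k ∈ C, 0 < N τ k)
    (hMM : ∀ σ ∈ R, ∀ σ' ∈ R, ∀ τ ∈ s, ∀ τ' ∈ s, M σ τ * M σ' τ' ≤ exp ΔM * (M σ τ' * M σ' τ))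
    (hNN : ∀ τ ∈ s, ∀ τ' ∈ s, ∀ k ∈ C, ∀ l ∈ C, N τ k * N τ' l ≤ exp ΔN * (N τ l * N τ' k)) :
    ∀ σ ∈ R, ∀ σ' ∈ R, ∀ k ∈ C, ∀ l ∈ C,
      (∑ τ ∈ s, M σ τ * N τ k) * (∑ τ ∈ s, M σ' τ * N τ l) ≤
        exp (Real.tanh (ΔM / 4) * ΔN) * ((∑ τ ∈ s, M σ τ * N τ l) * (∑ τ ∈ s, M σ' τ * N τ k)) := by
  intro σ hσ σ' hσ' k hk l hl
  exact two_rows_le_exp_tanh_mul (s := s) (a := M σ) (b := M σ') (x := fun τ => N τ l) (y := fun τ => N τ k) hΔN hΔM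
    (hM σ hσ) (hM σ' hσ') (fun τ hτ => hN τ hτ l hl) (fun τ hτ => hN τ hτ k hk)
    (fun τ hτ τ' hτ' => hNN τ hτ τ' hτ' k hk l hl) (fun τ hτ τ' hτ' => hMM σ hσ σ' hσ' τ hτ τ' hτ')

/-- the transposed reading: `Δ(M∘N) ≤ tanh(Δ_N∕4)·Δ_M`. [folklore] -/
theorem crossRatio_comp_le_exp_tanh_mul' (hΔM : 0 ≤ ΔM) (hΔN : 0 ≤ ΔN)
    (hM : ∀ σ ∈ R, ∀ τ ∈ s, 0 < M σ τ) (hN : ∀ τ ∈ s, ∀ k ∈ C, 0 < N τ k)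
    (hMM : ∀ σ ∈ R, ∀ σ' ∈ R, ∀ τ ∈ s, ∀ τ' ∈ s, M σ τ * M σ' τ' ≤ exp ΔM * (M σ τ' * M σ' τ))
    (hNN : ∀ τ ∈ s, ∀ τ' ∈ s, ∀ k ∈ C, ∀ l ∈ C, N τ k * N τ' l ≤ exp ΔN * (N τ l * N τ' k)) :
    ∀ σ ∈ R, ∀ σ' ∈ R, ∀ k ∈ C, ∀ l ∈ C,
      (∑ τ ∈ s, M σ τ * N τ k) * (∑ τ ∈ s, M σ' τ * N τ l) ≤
        exp (Real.tanh (ΔN / 4) * ΔM) * ((∑ τ ∈ s, M σ τ * N τ l) * (∑ τ ∈ s, M σ' τ * N τ k)) := by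
  intro σ hσ σ' hσ' k hk l hl
  have h := two_rows_le_exp_tanh_mul (s := s) (a := fun τ => N τ k) (b := fun τ => N τ l) (x := M σ') (y := M σ) hΔM hΔN
    (fun τ hτ => hN τ hτ k hk) (fun τ hτ => hN τ hτ l hl) (hM σ' hσ') (hM σ hσ)
    (fun τ hτ τ' hτ' => mul_comm (M σ τ') (M σ' τ) ▸ hMM σ hσ σ' hσ' τ hτ τ' hτ')
    (fun τ hτ τ' hτ' => mul_comm (N τ l) (N τ' k) ▸ hNN τ hτ τ' hτ' k hk l hl)
  have e1 : ∑ τ ∈ s, N τ k * M σ τ = ∑ τ ∈ s, M σ τ * N τ k := Finset.sum_congr rfl fun τ _ => mul_comm _ _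
  have e2 : ∑ τ ∈ s, N τ l * M σ' τ = ∑ τ ∈ s, M σ' τ * N τ l := Finset.sum_congr rfl fun τ _ => mul_comm _ _
  have e3 : ∑ τ ∈ s, N τ k * M σ' τ = ∑ τ ∈ s, M σ' τ * N τ k := Finset.sum_congr rfl fun τ _ => mul_comm _ _
  have e4 : ∑ τ ∈ s, N τ l * M σ τ = ∑ τ ∈ s, M σ τ * N τ l := Finset.sum_congr rfl fun τ _ => mul_comm _ _
  rw [e1, e2, e3, e4] at h
  calc (∑ τ ∈ s, M σ τ * N τ k) * (∑ τ ∈ s, M σ' τ * N τ l)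
      ≤ exp (Real.tanh (ΔN / 4) * ΔM) * ((∑ τ ∈ s, M σ' τ * N τ k) * (∑ τ ∈ s, M σ τ * N τ l)) := h
    _ = exp (Real.tanh (ΔN / 4) * ΔM) * ((∑ τ ∈ s, M σ τ * N τ l) * (∑ τ ∈ s, M σ' τ * N τ k)) := by ring

/-! ## §3 Positivity of the composite -/

/-- the composite of a positive left factor and a non-negative right factor whose every column meets `s` is positive. [folklore] -/
theorem comp_pos (hM : ∀ σ ∈ R, ∀ τ ∈ s, 0 < M σ τ) (hN : ∀ τ ∈ s, ∀ k ∈ C, 0 ≤ N τ k)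
    (hcol : ∀ k ∈ C, ∃ τ ∈ s, 0 < N τ k) :
    ∀ σ ∈ R, ∀ k ∈ C, 0 < ∑ τ ∈ s, M σ τ * N τ k := by
  intro σ hσ k hk
  obtain ⟨τ₀, hτ₀, hpos⟩ := hcol k hk
  have hle : M σ τ₀ * N τ₀ k ≤ ∑ τ ∈ s, M σ τ * N τ k :=
    Finset.single_le_sum (f := fun τ => M σ τ * N τ k) (fun τ hτ => mul_nonneg (hM σ hσ τ hτ).le (hN τ hτ k hk)) hτ₀
  exact lt_of_lt_of_le (mul_pos (hM σ hσ τ₀ hτ₀) hpos) hle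

end Summit.QuantumFields.YangMills.BalabanUVNodes.N19BirkhoffContractionComposite

end
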